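import Summits.NavierStokesRegularity.NavierStokesRegularity.Theorems.SoloSalvageWu2026AnnulusWeak
import Mathlib.MeasureTheory.Integral.MeanInequalities
import HarnessLib

/-!
# C177 `Wu2026` — TRUE column, Prop 3.4 (part 3/4): the renormalisation `Ψ_τ` and the decay of the
# renormalised flux on dyadic annuli

D-0090 NS-CLAIMS sweep, claim C177 (W. Wu, arXiv:2608.22471v1), skeleton
`Literature/Claims/NS/Wu2026.lean` (typist-10 g6; rev 2 p560520); TRUE-column kernel objects for the
consumed binder `hP34` of `claim_of_steps''` — Proposition 3.4 p.22 l.3–8 (proof p.22 l.9 – p.23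
l.46) «For every τ > 0, F_τ = 0. (3.66) Moreover, ∫_{S_r} QV·n dS = 0 for almost every r > 0.
(3.67)», typed as `Step_P34` (companion laws `div(β(Q)V) = 0` in `D'({|y| > 1})` for all
`β ∈ C¹` with `β'` bounded ⟹ `ZeroRadialFlux (Ioi 1) T.V T.Q`). Records, not a verdict (row #164
lettered «discharges», RULINGS v1.51/v1.54); salvage-p1 g5 (DECONFLICT 20:19Z).

This file: the truncations `Ψ_τ(z) = z(1 − e^{−z²/τ})` of (3.62)–(3.63) (`C¹`, `|Ψ_τ'| ≤ 3`,
`|Ψ_τ(z)| ≤ |z|`, `|Ψ_τ(z)| ≤ |z|³/τ`, `Ψ_τ → id` as `τ → 0⁺`, interpolation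
`|Ψ_τ(z)| ≤ τ^{−1/16}|z|^{9/8}`), and the annulus decay
`∫_{A_R}|Ψ_τ(Q)||V| ≤ τ^{−1/16} c R^{5/6}` (`Tangent.lintegral_annulus_psiTau_le`: Hölder `(3/2, 3)`
and the layer cake of part 2 for `|Q|^{27/16}`, `|V|³`) — the quantitative form of (3.68)–(3.71).

WHAT THIS IS NOT: not a claim about NS regularity or blow-up; not a claim about any author beyond
the typed locator.
-/

noncomputable section

set_option linter.dupNamespace false

open MeasureTheory Set Function Filter Topology Metric
open scoped ENNReal NNReal RealInnerProductSpace Topology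

namespace Summit.NavierStokesRegularity.NavierStokesRegularity.Theorems.Wu2026Salvage

open Literature.Analysis.FluidPDE Literature.Analysis.FunctionSpaces Literature.Claims.NS.Wu2026

/-! ### The renormalisation `Ψ_τ(z) = z(1 − e^{−z²/τ})` (3.62) -/

/-- `Ψ_τ` has derivative `(1 − e^{−z²/τ}) + (2z²/τ) e^{−z²/τ}`. [cite: Wu2026, (3.62)–(3.63) p.22 l.9–20] -/
theorem hasDerivAt_psiTau (τ z : ℝ) :
    HasDerivAt (fun z : ℝ => z * (1 - Real.exp (-z ^ 2 / τ)))
      ((1 - Real.exp (-z ^ 2 / τ)) + z * (Real.exp (-z ^ 2 / τ) * (2 * z / τ))) z := by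
  have h1 : HasDerivAt (fun z : ℝ => -z ^ 2 / τ) (-(2 * z) / τ) z := by
    have := ((hasDerivAt_pow 2 z).neg).div_const τ
    simpa using this
  have h2 : HasDerivAt (fun z : ℝ => Real.exp (-z ^ 2 / τ)) (Real.exp (-z ^ 2 / τ) * (-(2 * z) / τ)) z :=
    h1.exp
  have h3 : HasDerivAt (fun z : ℝ => 1 - Real.exp (-z ^ 2 / τ))
      (-(Real.exp (-z ^ 2 / τ) * (-(2 * z) / τ))) z := by
    simpa using h2.const_sub 1
  have h4 := (hasDerivAt_id' z).mul h3
  refine h4.congr_deriv ?_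
  ring

/-- `Ψ_τ ∈ C¹` with `|Ψ_τ'| ≤ 3` (for `τ > 0`): `0 ≤ 1 − e^{−s} ≤ 1` and `s e^{−s} ≤ 1`, `s = z²/τ`.
[cite: Wu2026, (3.62)–(3.63) p.22 l.9–20] -/
theorem psiTau_contDiff_and_deriv_bound {τ : ℝ} (hτ : 0 < τ) :
    ContDiff ℝ 1 (fun z : ℝ => z * (1 - Real.exp (-z ^ 2 / τ))) ∧
      ∃ L : ℝ, ∀ z, ‖deriv (fun z : ℝ => z * (1 - Real.exp (-z ^ 2 / τ))) z‖ ≤ L := by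
  refine ⟨?_, 3, fun z => ?_⟩
  · have he : ContDiff ℝ 1 (fun z : ℝ => Real.exp (-z ^ 2 / τ)) :=
      Real.contDiff_exp.comp ((contDiff_id.pow 2).neg.div_const τ)
    exact contDiff_id.mul (contDiff_const.sub he)
  · rw [(hasDerivAt_psiTau τ z).deriv]
    set s : ℝ := z ^ 2 / τ with hs
    have hs0 : 0 ≤ s := div_nonneg (sq_nonneg _) hτ.le
    have hexp : Real.exp (-z ^ 2 / τ) = Real.exp (-s) := by rw [hs, neg_div]
    rw [hexp]
    have he1 : Real.exp (-s) ≤ 1 := by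
      rw [Real.exp_le_one_iff]; linarith
    have he0 : 0 < Real.exp (-s) := Real.exp_pos _
    -- `s e^{-s} ≤ 1`
    have hse : s * Real.exp (-s) ≤ 1 := by
      have h := Real.add_one_le_exp s
      have : s * Real.exp (-s) ≤ Real.exp s * Real.exp (-s) :=
        mul_le_mul_of_nonneg_right (by linarith) he0.le
      rw [← Real.exp_add, add_neg_cancel, Real.exp_zero] at this
      exact this
    have hzz : z * (Real.exp (-s) * (2 * z / τ)) = 2 * (s * Real.exp (-s)) := by
      rw [hs]; ring
    rw [hzz, Real.norm_eq_abs]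
    have hsnn : 0 ≤ s * Real.exp (-s) := mul_nonneg hs0 he0.le
    rw [abs_le]
    constructor <;> nlinarith

/-- `|Ψ_τ(z)| ≤ |z|` (for `τ > 0`). [cite: Wu2026, (3.62) p.22 l.9–12] -/
theorem abs_psiTau_le_abs {τ : ℝ} (hτ : 0 < τ) (z : ℝ) :
    |z * (1 - Real.exp (-z ^ 2 / τ))| ≤ |z| := by
  rw [abs_mul]
  have h0 : 0 ≤ 1 - Real.exp (-z ^ 2 / τ) := by
    rw [sub_nonneg, Real.exp_le_one_iff, neg_div]
    exact neg_nonpos.2 (div_nonneg (sq_nonneg _) hτ.le)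
  have h1 : 1 - Real.exp (-z ^ 2 / τ) ≤ 1 := by linarith [Real.exp_pos (-z ^ 2 / τ)]
  calc |z| * |1 - Real.exp (-z ^ 2 / τ)| = |z| * (1 - Real.exp (-z ^ 2 / τ)) := by
        rw [abs_of_nonneg h0]
    _ ≤ |z| * 1 := by gcongr
    _ = |z| := mul_one _

/-- `|Ψ_τ(z)| ≤ |z|³/τ` (for `τ > 0`; `1 − e^{−s} ≤ s`). [cite: Wu2026, (3.69) p.22 l.36–40] -/
theorem abs_psiTau_le_cube {τ : ℝ} (hτ : 0 < τ) (z : ℝ) :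
    |z * (1 - Real.exp (-z ^ 2 / τ))| ≤ |z| ^ 3 / τ := by
  rw [abs_mul]
  have h0 : 0 ≤ 1 - Real.exp (-z ^ 2 / τ) := by
    rw [sub_nonneg, Real.exp_le_one_iff, neg_div]
    exact neg_nonpos.2 (div_nonneg (sq_nonneg _) hτ.le)
  have h1 : 1 - Real.exp (-z ^ 2 / τ) ≤ z ^ 2 / τ := by
    have := Real.add_one_le_exp (-z ^ 2 / τ)
    rw [neg_div] at this ⊢
    linarith
  calc |z| * |1 - Real.exp (-z ^ 2 / τ)| = |z| * (1 - Real.exp (-z ^ 2 / τ)) := by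
        rw [abs_of_nonneg h0]
    _ ≤ |z| * (z ^ 2 / τ) := by gcongr
    _ = |z| ^ 3 / τ := by rw [← sq_abs]; ring

/-- `Ψ_{1/(n+1)}(z) → z` as `n → ∞`. [cite: Wu2026, p.23 l.20–30 (τ ↓ 0)] -/
theorem tendsto_psiTau (z : ℝ) :
    Tendsto (fun n : ℕ => z * (1 - Real.exp (-z ^ 2 / (1 / ((n : ℝ) + 1))))) atTop (𝓝 z) := by
  by_cases hz : z = 0
  · simp [hz]
  · have hz2 : 0 < z ^ 2 := by positivity
    have h0 : Tendsto (fun n : ℕ => z ^ 2 * ((n : ℝ) + 1)) atTop atTop :=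
      (tendsto_natCast_atTop_atTop.atTop_add tendsto_const_nhds).const_mul_atTop hz2
    have h1 : Tendsto (fun n : ℕ => -z ^ 2 / (1 / ((n : ℝ) + 1))) atTop atBot := by
      refine (tendsto_neg_atTop_atBot.comp h0).congr fun n => ?_
      simp only [Function.comp_def]
      rw [div_div_eq_mul_div, div_one]
      ring
    have h2 : Tendsto (fun n : ℕ => Real.exp (-z ^ 2 / (1 / ((n : ℝ) + 1)))) atTop (𝓝 0) :=
      Real.tendsto_exp_atBot.comp h1
    have h3 := ((tendsto_const_nhds (x := (1 : ℝ))).sub h2).const_mul z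
    simpa using h3


/-! ### Decay of the renormalised flux on dyadic annuli ((3.68)–(3.71)) -/

/-- Interpolation: `|Ψ_τ(z)| ≤ τ^{-1/16} |z|^{9/8}` (from `|Ψ_τ(z)| ≤ |z|` and `≤ |z|³/τ`). [cite: Wu2026, (3.69) p.22 l.36–40] -/
theorem abs_psiTau_le_rpow {τ : ℝ} (hτ : 0 < τ) (z : ℝ) :
    |z * (1 - Real.exp (-z ^ 2 / τ))| ≤ τ ^ (-(1 : ℝ) / 16) * |z| ^ ((9 : ℝ) / 8) := by
  set x : ℝ := |z * (1 - Real.exp (-z ^ 2 / τ))| with hx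
  have hx0 : 0 ≤ x := abs_nonneg _
  have ha : x ≤ |z| := abs_psiTau_le_abs hτ z
  have hb : x ≤ |z| ^ 3 / τ := abs_psiTau_le_cube hτ z
  have hz := abs_nonneg z
  -- the right-hand side equals `|z|^{15/16} (|z|³/τ)^{1/16}`
  have hrhs : τ ^ (-(1 : ℝ) / 16) * |z| ^ ((9 : ℝ) / 8) =
      |z| ^ ((15 : ℝ) / 16) * (|z| ^ 3 / τ) ^ ((1 : ℝ) / 16) := by
    rw [Real.div_rpow (by positivity) hτ.le, ← Real.rpow_natCast, ← Real.rpow_mul hz]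
    rw [show -(1 : ℝ) / 16 = -((1 : ℝ) / 16) by ring, Real.rpow_neg hτ.le]
    have : |z| ^ ((9 : ℝ) / 8) = |z| ^ ((15 : ℝ) / 16) * |z| ^ ((3 : ℕ) * ((1 : ℝ) / 16)) := by
      rw [← Real.rpow_add' hz (by norm_num)]; norm_num
    rw [this]; ring
  rw [hrhs]
  rcases eq_or_lt_of_le hx0 with h0 | hpos
  · rw [← h0]; positivity
  · calc x = x ^ ((15 : ℝ) / 16) * x ^ ((1 : ℝ) / 16) := by
          rw [← Real.rpow_add hpos]; norm_num
      _ ≤ |z| ^ ((15 : ℝ) / 16) * (|z| ^ 3 / τ) ^ ((1 : ℝ) / 16) := by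
          gcongr

section Decay

variable {ν : ℝ} {v : E3 → E3} {p : E3 → ℝ}

/-- **The renormalised annulus flux is `o(R)`**: there are `c ≥ 0` with
`∫_{A_R} |Ψ_τ(Q)||V| ≤ τ^{−1/16} c R^{5/6}` for all `R > 0` — Hölder with exponents `(3/2, 3)`
after `|Ψ_τ(Q)| ≤ τ^{−1/16}|Q|^{9/8}`, and the annulus layer cake for `|Q|^{27/16}` (`27/16 < 9/4`)
and `|V|³` (`3 < 9/2`) at the heights `R^{−4/3}`, `R^{−2/3}`. [cite: Wu2026, (3.68)–(3.71) p.22 l.28 – p.23 l.19] -/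
theorem Tangent.lintegral_annulus_psiTau_le (T : Tangent ν v p) :
    ∃ c : ℝ, 0 ≤ c ∧ ∀ τ : ℝ, 0 < τ → ∀ R : ℝ, 0 < R →
      ∫⁻ y in annulus R, ENNReal.ofReal (|T.Q y * (1 - Real.exp (-(T.Q y) ^ 2 / τ))| * ‖T.V y‖) ≤
        ENNReal.ofReal (τ ^ (-(1 : ℝ) / 16) * (c * R ^ ((5 : ℝ) / 6))) := by
  obtain ⟨C, hC0, hC⟩ := Tangent.eWeakLpPow_annulus_le T
  obtain ⟨hVm, hPm, -⟩ := T.locInt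
  have hQm := Tangent.aestronglyMeasurable_Q T
  set B : ℝ := 8 * (volume (ball (0 : E3) 1)).toReal with hB
  have hB0 : 0 ≤ B := by positivity
  -- constants
  set cQ : ℝ := B + 3 * C with hcQ
  set cV : ℝ := B + 2 * C with hcV
  refine ⟨cQ ^ ((2 : ℝ) / 3) * cV ^ ((1 : ℝ) / 3), by positivity, fun τ hτ R hR => ?_⟩
  obtain ⟨hWV, hWQ⟩ := hC R hR
  -- layer cake for `|Q|^{27/16}` at height `R^{-4/3}`
  have hIQ : ∫⁻ y in annulus R, ‖T.Q y‖ₑ ^ ((27 : ℝ) / 16) ≤ ENNReal.ofReal (cQ * R ^ ((3 : ℝ) / 4)) := by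
    have h := setLIntegral_annulus_rpow_le hR hQm.restrict (p := 9 / 4) (r := 27 / 16)
      (by norm_num) (by norm_num) hC0 hWQ (lam := R ^ (-(4 : ℝ) / 3)) (Real.rpow_pos_of_pos hR _)
    refine h.trans (le_of_eq ?_)
    congr 1
    have e1 : (R ^ (-(4 : ℝ) / 3)) ^ ((27 : ℝ) / 16) = R ^ (-(9 : ℝ) / 4) := by
      rw [← Real.rpow_mul hR.le]; norm_num
    have e2 : (R ^ (-(4 : ℝ) / 3)) ^ ((27 : ℝ) / 16 - 9 / 4) = R ^ ((3 : ℝ) / 4) := by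
      rw [← Real.rpow_mul hR.le]; norm_num
    have e3 : R ^ 3 * R ^ (-(9 : ℝ) / 4) = R ^ ((3 : ℝ) / 4) := by
      rw [← Real.rpow_natCast, ← Real.rpow_add hR]; norm_num
    rw [e1, e2, hcQ]
    calc B * R ^ 3 * R ^ (-(9 : ℝ) / 4) + 27 / 16 / (9 / 4 - 27 / 16) * R ^ ((3 : ℝ) / 4) * C
        = B * (R ^ 3 * R ^ (-(9 : ℝ) / 4)) + 3 * R ^ ((3 : ℝ) / 4) * C := by ring
      _ = (B + 3 * C) * R ^ ((3 : ℝ) / 4) := by rw [e3]; ring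
  -- layer cake for `|V|^3` at height `R^{-2/3}`
  have hIV : ∫⁻ y in annulus R, ‖T.V y‖ₑ ^ (3 : ℝ) ≤ ENNReal.ofReal (cV * R) := by
    have h := setLIntegral_annulus_rpow_le hR hVm.restrict (p := 9 / 2) (r := 3)
      (by norm_num) (by norm_num) hC0 hWV (lam := R ^ (-(2 : ℝ) / 3)) (Real.rpow_pos_of_pos hR _)
    refine h.trans (le_of_eq ?_)
    congr 1
    have e1 : (R ^ (-(2 : ℝ) / 3)) ^ (3 : ℝ) = R ^ (-(2 : ℝ)) := by
      rw [← Real.rpow_mul hR.le]; norm_num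
    have e2 : (R ^ (-(2 : ℝ) / 3)) ^ ((3 : ℝ) - 9 / 2) = R := by
      rw [← Real.rpow_mul hR.le]; norm_num
    have e3 : R ^ 3 * R ^ (-(2 : ℝ)) = R := by
      rw [← Real.rpow_natCast, ← Real.rpow_add hR]; norm_num
    rw [e1, e2, hcV]
    calc B * R ^ 3 * R ^ (-(2 : ℝ)) + 3 / (9 / 2 - 3) * R * C
        = B * (R ^ 3 * R ^ (-(2 : ℝ))) + 2 * R * C := by ring
      _ = (B + 2 * C) * R := by rw [e3]; ring
  -- pointwise interpolation and Hölder `(3/2, 3)`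
  set f : E3 → ℝ≥0∞ := fun y => ‖T.Q y‖ₑ ^ ((9 : ℝ) / 8) with hf
  set g : E3 → ℝ≥0∞ := fun y => ‖T.V y‖ₑ with hg
  have hfm : AEMeasurable f (volume.restrict (annulus R)) := hQm.restrict.enorm.pow_const _
  have hgm : AEMeasurable g (volume.restrict (annulus R)) := hVm.restrict.enorm
  have hpt : ∀ y, ENNReal.ofReal (|T.Q y * (1 - Real.exp (-(T.Q y) ^ 2 / τ))| * ‖T.V y‖) ≤
      ENNReal.ofReal (τ ^ (-(1 : ℝ) / 16)) * (f * g) y := by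
    intro y
    have h1 := abs_psiTau_le_rpow hτ (T.Q y)
    have hτ' : 0 ≤ τ ^ (-(1 : ℝ) / 16) := Real.rpow_nonneg hτ.le _
    calc ENNReal.ofReal (|T.Q y * (1 - Real.exp (-(T.Q y) ^ 2 / τ))| * ‖T.V y‖)
        ≤ ENNReal.ofReal (τ ^ (-(1 : ℝ) / 16) * |T.Q y| ^ ((9 : ℝ) / 8) * ‖T.V y‖) :=
          ENNReal.ofReal_le_ofReal (mul_le_mul_of_nonneg_right h1 (norm_nonneg _))
      _ = ENNReal.ofReal (τ ^ (-(1 : ℝ) / 16)) * (f * g) y := by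
          simp only [Pi.mul_apply, hf, hg]
          rw [← ofReal_norm, ← ofReal_norm, Real.norm_eq_abs,
            ENNReal.ofReal_rpow_of_nonneg (abs_nonneg _) (by norm_num : (0 : ℝ) ≤ 9 / 8),
            ← ENNReal.ofReal_mul (Real.rpow_nonneg (abs_nonneg _) _), ← ENNReal.ofReal_mul hτ',
            mul_assoc]
  have hholder := ENNReal.lintegral_mul_le_Lp_mul_Lq (volume.restrict (annulus R))
    (p := 3 / 2) (q := 3) ⟨by norm_num, by norm_num, by norm_num⟩ hfm hgm
  have hfp : ∀ y, f y ^ ((3 : ℝ) / 2) = ‖T.Q y‖ₑ ^ ((27 : ℝ) / 16) := fun y => by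
    rw [hf, ← ENNReal.rpow_mul]; norm_num
  calc ∫⁻ y in annulus R, ENNReal.ofReal (|T.Q y * (1 - Real.exp (-(T.Q y) ^ 2 / τ))| * ‖T.V y‖)
      ≤ ∫⁻ y in annulus R, ENNReal.ofReal (τ ^ (-(1 : ℝ) / 16)) * (f * g) y := lintegral_mono hpt
    _ = ENNReal.ofReal (τ ^ (-(1 : ℝ) / 16)) * ∫⁻ y in annulus R, (f * g) y := by
        rw [lintegral_const_mul'' _ (hfm.mul hgm)]
    _ ≤ ENNReal.ofReal (τ ^ (-(1 : ℝ) / 16)) *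
          ((∫⁻ y in annulus R, f y ^ ((3 : ℝ) / 2)) ^ (1 / ((3 : ℝ) / 2)) *
            (∫⁻ y in annulus R, g y ^ (3 : ℝ)) ^ (1 / (3 : ℝ))) := mul_le_mul' le_rfl hholder
    _ ≤ ENNReal.ofReal (τ ^ (-(1 : ℝ) / 16)) *
          (ENNReal.ofReal (cQ * R ^ ((3 : ℝ) / 4)) ^ (1 / ((3 : ℝ) / 2)) *
            ENNReal.ofReal (cV * R) ^ (1 / (3 : ℝ))) := by
        have hIQ' : ∫⁻ y in annulus R, f y ^ ((3 : ℝ) / 2) ≤ ENNReal.ofReal (cQ * R ^ ((3 : ℝ) / 4)) :=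
          calc ∫⁻ y in annulus R, f y ^ ((3 : ℝ) / 2) = ∫⁻ y in annulus R, ‖T.Q y‖ₑ ^ ((27 : ℝ) / 16) :=
                lintegral_congr fun y => hfp y
            _ ≤ _ := hIQ
        exact mul_le_mul' le_rfl (mul_le_mul' (ENNReal.rpow_le_rpow hIQ' (by norm_num))
          (ENNReal.rpow_le_rpow hIV (by norm_num)))
    _ = ENNReal.ofReal (τ ^ (-(1 : ℝ) / 16) * (cQ ^ ((2 : ℝ) / 3) * cV ^ ((1 : ℝ) / 3) * R ^ ((5 : ℝ) / 6))) := by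
        have hcQ0 : 0 ≤ cQ := by positivity
        have hcV0 : 0 ≤ cV := by positivity
        rw [ENNReal.ofReal_rpow_of_nonneg (by positivity) (by norm_num),
          ENNReal.ofReal_rpow_of_nonneg (by positivity) (by norm_num),
          ← ENNReal.ofReal_mul (by positivity), ← ENNReal.ofReal_mul (Real.rpow_nonneg hτ.le _)]
        congr 1
        rw [show (1 : ℝ) / ((3 : ℝ) / 2) = 2 / 3 by norm_num, Real.mul_rpow hcQ0 (by positivity),
          Real.mul_rpow hcV0 hR.le, ← Real.rpow_mul hR.le]
        have e : R ^ ((3 : ℝ) / 4 * (2 / 3)) * R ^ ((1 : ℝ) / 3) = R ^ ((5 : ℝ) / 6) := by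
          rw [← Real.rpow_add hR]; norm_num
        calc τ ^ (-(1 : ℝ) / 16) * (cQ ^ ((2 : ℝ) / 3) * R ^ ((3 : ℝ) / 4 * (2 / 3)) * (cV ^ ((1 : ℝ) / 3) * R ^ ((1 : ℝ) / 3)))
            = τ ^ (-(1 : ℝ) / 16) * (cQ ^ ((2 : ℝ) / 3) * cV ^ ((1 : ℝ) / 3) * (R ^ ((3 : ℝ) / 4 * (2 / 3)) * R ^ ((1 : ℝ) / 3))) := by ring
          _ = _ := by rw [e]

end Decay


end Summit.NavierStokesRegularity.NavierStokesRegularity.Theorems.Wu2026Salvage
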